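import Literature.MathematicalPhysics.QuantumFieldTheory.Balaban1983to89.Beta.WindowInterface
import Literature.MathematicalPhysics.QuantumFieldTheory.GawedzkiKupiainen1985.BubbleLogLowerBound

/-!
# `Balaban1983to89.Beta.TwoPowerLegs` — the `k ≥ 1` LEG ADAPTER: a propagator family with TWO-powers-better
undifferentiated asymptotics is a table of `BubbleTransfer.Leg`s (undifferentiated, gradient, and — given SHARP
differences — mixed second-difference legs), with explicit `(L,k)`-free constants; the `k = 0` free rung UNCONDITIONALLY
(β sub-cell, row BETA-an3 gen 5, node BETA-an3-g5-LEGS; BETA-SPEC v1.9g §6.12 OWNERS «(vi) an3 lineage [gen 5: C_k `Leg`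
adapters, k = 0 `Lawler137Shape` discharge from lit1 v1.1]», RULING (R7) «C_k, not Γ_k»)

HONEST FRAMING (cell rule, verbatim): discharging `BetaPertH` makes Bałaban's UV stability UNCONDITIONAL — a real
constructive-QFT result; it is NOT the continuum limit and NOT the Clay problem.  (Gloss, BETA-SPEC v1.8d/v1.9b
l. 17–18, GAPS G-ref2-14 (a) / G-ref2-20 (a), verbatim: «UNCONDITIONAL» in [Balaban1989LargeFieldII] (B16) p. 355's
interval-hypothesis sense ONLY (`FlowStepRuns.p355Unconditional_of_partialSums` keeps `hnodes`); the located leaves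
G-adv3-2 (left inequality of (0.1)/(2.50), d = 4), G-adv3-1 (U2 transfer of B14 Cor. 3's lower bound) and `SecondExpLeaf`
REMAIN.  Gloss 2, BETA-SPEC v1.9e, beta-ref C-beta-78, BINDING: «unconditional» = `Beta.Assembly.EventualForm`-unconditional END
statement, NOT «Theorem 2 as printed».)  THIS MODULE DISCHARGES NOTHING of the series and asserts nothing about Bałaban's
propagators, kernels or β-functions: every statement below is about an ARBITRARY family `g : ℕ → ℕ → ℤ⁴ → ℝ` satisfying
stated bounds, about the explicit rational functions `|x|⁻²`, `∂|x|⁻²`, `∂∂|x|⁻²` of `BubbleTransfer` §1, or (§5) about the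
tree's free lattice Green function `LatticeModels.latticeGreen`.  Every declaration is `[folklore]`.  Value = kernel
certificate (audit cell `pub-balaban`, β sub-cell, unit `b2b-balaban-beta-an3-g5`), NOT summit progress.

WHAT THIS MODULE IS.  RULING (R7) (BETA-SPEC v1.9f §7.12 (b)) fixes what a LEG of the (W1) table is for `k ≥ 1`: an entry
`C_k` of the inverse of the `U = 1` effective quadratic form on the unit lattice `ℤ⁴` (an L-free covariant-type object,
NOT Bałaban's block-constrained fluctuation propagator `Γ_k`, whose Woodbury correction is charged to (W2)), «and their
lattice differences», each to be shown a `BubbleTransfer.Leg`: lattice function = continuum part + an error ONE POWER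
BETTER with constants FREE of `(L,k)`.  This module is the ADAPTER that turns the natural OUTPUT SHAPE of any such analysis
into the four legs of `WindowInterface.stepBal_le_of_bfInterface`:
* INPUT (`TwoPower`, §2): a family `g L k : ℤ⁴ → ℝ` with (F1) `|g L k v − c₄/|v|₂²| ≤ B/‖v‖∞⁴` for `v ≠ 0` — the
  undifferentiated asymptotics TWO powers better than the leading `c₄|v|⁻²` (degree 2) — and (F2) `|g L k v| ≤ U` for all
  `v` (incl. `v = 0`), `B, U` free of `(L,k)`.  (At `k = 0`, `g = latticeGreen/2` has (F1) by the tree's Lawler–Limic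
  Thm 4.3.1 `latticeGreen_asymptotics`, §5; for `k ≥ 1` (F1)+(F2) are what the carrier of `C_k` must deliver — row an5's
  successor per §6.12 OWNERS, or the companion position-space module `BlockLegs` for the block-averaged covariance.)
* OUTPUT (§2–§3): `baseLeg` (degree 2, continuum part `c₄|x|⁻²`), `fwdLeg μ` / `bwdLeg μ` (unit forward/backward
  differences, degree 3, continuum part `c₄∂_μ|x|⁻²`, error `(17B + 112c₄ + 2U + 2c₄)/‖w‖∞⁴`) — from the explicit
  SECOND-ORDER TAYLOR BOUND `|1/|X+ζ|₂² − 1/|X|₂² − ζ·∇(1/|X|₂²)| ≤ 112‖ζ‖∞²/‖X‖∞⁴` for `2‖ζ‖∞ ≤ ‖X‖∞` (§1,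
  `taylor2_invSq`, pure algebra: numerator `4ι² + 2ιz − zR` over `R²R′`); and, GIVEN in addition (F3) SHARP unit
  differences `|∇_i g L k (v) − c₄∇_i|·|₂⁻²(v)| ≤ B₃/‖v‖∞⁵` (three powers better; at `k = 0` this is lit1-g5's KERNEL
  theorem `latticeGreen_diff_sub_rpow_le_sharp`, the sharp Lawler (1.36)), the MIXED second-difference leg `mixedLeg μ ν`
  (degree 4, continuum part `c₄∂_μ∂_ν|x|⁻²`) from the THIRD-ORDER Taylor bound `taylor3_invSq` (remainder
  `3712‖ζ‖∞³/‖X‖∞⁵`) and the polarisation identity — NO `Lawler137Shape` hypothesis.  (v1.1, §2b, an2-g3 NOTE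
  2026-08-18T23:06:25Z (2)): TRANSLATED legs `w ↦ g(w + α)` (degree 2, `shiftLeg`) and DIFFERENCED legs `g(w + α) − g(w)`
  along any bounded shift `‖α‖∞ ≤ r` (degree 3, continuum part `c₄α·∇|x|⁻²`, `diffLeg`), constants explicit in `r`, `B`, `U`.
* PLUG (§4): with the background-field coefficients `2N·N·6`, `2N·N·10` the four legs meet `hval_of_bfTable`, so (F1)+(F2)
  (+ any two-derivative leg `H`, or + (F3)) together with (W2), (W3) and window comparability give the wall
  `stepBal N L − A ≤ β⁰(L,k)` (`stepBal_le_of_twoPower`, `stepBal_le_of_twoPowerSharp`) — i.e. (W1) for the family `g` IS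
  (F1)+(F2)+(F3), three scalar inequalities with `(L,k)`-free constants.
* THE FREE RUNG UNCONDITIONALLY (§5): `free : TwoPower` (`g = latticeGreen/2`, all `(L,k)`), `free_sharp` from lit1 v1.1;
  hence `stepBal_le_of_freeSharp` = `WindowInterface.stepBal_le_of_freeInterface` WITHOUT its three `Lawler137Shape`
  hypotheses (BETA-SPEC §6.12: «an3's `Lawler137Shape` hypotheses at k = 0 are now dischargeable (adapter wanted, an3
  gen 5)» — done here).

WHAT THIS MODULE DOES NOT DO.  It does not produce (F1)–(F3) for Bałaban's `C_k`, `k ≥ 1` (row an5's successor / the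
companion `BlockLegs` for the block-averaged free covariance), says nothing about which table Bałaban's (1.22) integrand is
(items (iii)/(iv), an2) nor about the slots (W2)/(W3); and (F3) for `k ≥ 1` is NOT implied by (F1) (it is the genuinely
second-order content of item (ii) in position space).

CITATION HEADER (cell ABSOLUTE RULE: the manuscripts under audit are context, never authority).
* [Balaban1989LargeFieldI] T. Bałaban, Large field renormalization. I, Comm. Math. Phys. 122 (1989) 175–202 — (1.20)–(1.24)
  pp. 8–9 (shape of β⁰, the claim (1.22)).  CONTEXT ONLY.  [Balaban1984PropagatorsI] T. Bałaban, Propagators and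
  renormalization transformations for lattice gauge theories. I, Comm. Math. Phys. 95 (1984) 17–40 (INDEX B5) — (1.61)–(1.62)
  p. 28 (the unit-lattice symbol of the block covariance as an alias sum).  CONTEXT ONLY (what `C_k` refers to; nothing of it
  is used).  (v1 of this header mis-keyed this line as «Balaban1985PropagatorsII … CMP 99» — corrected in v1.1; CONTEXT line,
  no statement affected.)
* [Lawler1991] G. F. Lawler, Intersections of Random Walks, Birkhäuser 1991 — Thm 1.5.4 p. 21, Thm 1.5.5 (1.36)–(1.37)
  p. 21; [LawlerLimic2010] Thm 4.3.1.  Enter ONLY through the TREE theorems `LatticeModels.latticeGreen_asymptotics`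
  (Thm 4.3.1) and `LatticeModels.latticeGreen_diff_sub_rpow_le_sharp` (lit1-g5, p180533).
* Internal division of labour (NOT citations): BETA-SPEC.md v1.9g §6.12 OWNERS / §7.12 RULING (R7); AN3.md v5 §10;
  an2-g3 NOTE 23:06:25Z (2) (translated/differenced legs).

Tags: [folklore] = elementary real analysis / algebra proved here, or a structure/definition asserting nothing.
No `axiom`, no `sorry`; every theorem's hypotheses are explicit binders.  Imports: `Beta.WindowInterface` (the plug) and
`GawedzkiKupiainen1985.BubbleLogLowerBound` ONLY for the elementary `toReal_sub` (gate dedup; nothing else of it is used).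
-/

noncomputable section

namespace Literature.MathematicalPhysics.QuantumFieldTheory.Balaban1983to89.Beta.TwoPowerLegs

open Finset
open Literature.Probability.LatticeModels (annulus latticeGreen)
open Literature.MathematicalPhysics.QuantumFieldTheory.Balaban1983to89
open Literature.MathematicalPhysics.QuantumFieldTheory.Balaban1983to89.Beta
open Literature.MathematicalPhysics.QuantumFieldTheory.Balaban1983to89.Beta.TransverseStructure
open Literature.MathematicalPhysics.QuantumFieldTheory.Balaban1983to89.Beta.TransverseLink
open Literature.MathematicalPhysics.QuantumFieldTheory.Balaban1983to89.Beta.LeadingCoefficient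
open Literature.MathematicalPhysics.QuantumFieldTheory.Balaban1983to89.Beta.DyadicShell
open Literature.MathematicalPhysics.QuantumFieldTheory.Balaban1983to89.Beta.LargeLWindow (WindowDecomposition)
open Literature.MathematicalPhysics.QuantumFieldTheory.Balaban1983to89.Beta.BubbleTransfer
open Literature.MathematicalPhysics.QuantumFieldTheory.Balaban1983to89.Beta.WindowInterface
open Literature.MathematicalPhysics.QuantumFieldTheory.GawedzkiKupiainen1985 (toReal_sub)

/-! ## §1. Sup-norm / Euclidean toolkit on `ℝ⁴` and the Taylor bounds of `|x|⁻²` to second and third order -/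

section Taylor

/-- The Euclidean pairing `Σ Xᵢζᵢ`. [folklore] -/
def ip (X ζ : E4) : ℝ := ∑ i, X i * ζ i

/-- `|X+ζ|² = |X|² + 2X·ζ + |ζ|²`. [folklore] -/
theorem r2_add (X ζ : E4) : r2 (X + ζ) = r2 X + 2 * ip X ζ + r2 ζ := by
  unfold r2 ip
  rw [Finset.mul_sum, ← Finset.sum_add_distrib, ← Finset.sum_add_distrib]
  exact Finset.sum_congr rfl fun i _ => by simp only [Pi.add_apply]; ring

/-- Cauchy–Schwarz: `(X·ζ)² ≤ |X|²|ζ|²`. [folklore] -/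
theorem ip_sq_le (X ζ : E4) : ip X ζ ^ 2 ≤ r2 X * r2 ζ := by
  unfold ip r2
  exact Finset.sum_mul_sq_le_sq_mul_sq _ _ _

/-- `|X|₂² ≤ 4‖X‖∞²` (`LeadingCoefficient.normSq_le` in `r2` notation). [folklore] -/
theorem r2_le_four_mul (X : E4) : r2 X ≤ 4 * ‖X‖ ^ 2 := by
  rw [r2_eq_normSq]; exact normSq_le X

/-- `‖X‖∞² ≤ |X|₂²`. [folklore] -/
theorem norm_sq_le_r2 (X : E4) : ‖X‖ ^ 2 ≤ r2 X := by
  rw [r2_eq_normSq]; exact norm_sq_le_normSq X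

/-- `|X·ζ| ≤ 4‖X‖∞‖ζ‖∞`. [folklore] -/
theorem abs_ip_le (X ζ : E4) : |ip X ζ| ≤ 4 * ‖X‖ * ‖ζ‖ := by
  unfold ip
  calc |∑ i, X i * ζ i| ≤ ∑ i, |X i * ζ i| := Finset.abs_sum_le_sum_abs _ _
    _ ≤ ∑ _i : Fin 4, ‖X‖ * ‖ζ‖ := Finset.sum_le_sum fun i _ => by
        rw [abs_mul]
        exact mul_le_mul (abs_apply_le_norm X i) (abs_apply_le_norm ζ i) (abs_nonneg _) (norm_nonneg _)
    _ = 4 * ‖X‖ * ‖ζ‖ := by simp; ring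

/-- The directional derivative: `Σ ζ_μ ∂_μ|X|⁻² = −2(X·ζ)/|X|₂⁴`. [folklore] -/
theorem sum_mul_d1InvSq (X ζ : E4) : ∑ μ, ζ μ * d1InvSq μ X = -2 * ip X ζ / r2 X ^ 2 := by
  simp only [d1InvSq, ip, Finset.mul_sum, Finset.sum_div]
  exact Finset.sum_congr rfl fun μ _ => by ring

/-- The Hessian quadratic form: `Σ_{ab} ζ_aζ_b ∂_a∂_b|X|⁻² = 8(X·ζ)²/|X|₂⁶ − 2|ζ|₂²/|X|₂⁴`. [folklore] -/
theorem sum_sum_mul_hessInvSq (X ζ : E4) :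
    ∑ a, ∑ b, ζ a * ζ b * hessInvSq a b X = 8 * ip X ζ ^ 2 / r2 X ^ 3 - 2 * r2 ζ / r2 X ^ 2 := by
  have h1 : ∑ a, ∑ b, ζ a * ζ b * (8 * X a * X b / r2 X ^ 3) = 8 * ip X ζ ^ 2 / r2 X ^ 3 := by
    have e : ip X ζ ^ 2 = (∑ a, X a * ζ a) * ∑ b, X b * ζ b := by rw [ip, sq]
    rw [e, Finset.sum_mul_sum, Finset.mul_sum, Finset.sum_div]
    refine Finset.sum_congr rfl fun a _ => ?_
    rw [Finset.mul_sum, Finset.sum_div]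
    exact Finset.sum_congr rfl fun b _ => by ring
  have h2 : ∑ a, ∑ b, ζ a * ζ b * (if a = b then 2 / r2 X ^ 2 else 0) = 2 * r2 ζ / r2 X ^ 2 := by
    have e : ∀ a, ∑ b, ζ a * ζ b * (if a = b then 2 / r2 X ^ 2 else 0) = ζ a ^ 2 * (2 / r2 X ^ 2) := by
      intro a
      rw [Finset.sum_eq_single a]
      · rw [if_pos rfl]; ring
      · intro b _ hb; rw [if_neg (Ne.symm hb)]; ring
      · intro h; exact absurd (Finset.mem_univ a) h
    simp_rw [e]
    rw [← Finset.sum_mul]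
    simp only [r2]
    ring
  have e : ∀ a b, ζ a * ζ b * hessInvSq a b X =
      ζ a * ζ b * (8 * X a * X b / r2 X ^ 3) - ζ a * ζ b * (if a = b then 2 / r2 X ^ 2 else 0) := by
    intro a b; rw [hessInvSq]; ring
  simp_rw [e, Finset.sum_sub_distrib]
  rw [h1, h2]

variable {X ζ : E4}

/-- Lower bound on the shifted point: `‖X‖∞/2 ≤ ‖X+ζ‖∞` when `2‖ζ‖∞ ≤ ‖X‖∞`. [folklore] -/
theorem half_norm_le_norm_add (h : 2 * ‖ζ‖ ≤ ‖X‖) : ‖X‖ / 2 ≤ ‖X + ζ‖ := by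
  have := norm_sub_le (X + ζ) ζ
  rw [add_sub_cancel_right] at this
  linarith

/-- **SECOND-ORDER TAYLOR BOUND FOR `|x|⁻²` (sup-norm currency)**: for `X ≠ 0`, `2‖ζ‖∞ ≤ ‖X‖∞`,
`|1/|X+ζ|₂² − 1/|X|₂² − Σ ζ_μ∂_μ|X|⁻²| ≤ 112‖ζ‖∞²/‖X‖∞⁴`.  (Exact numerator `4ι² + 2ιz − zR` over `R²R′`,
`R = |X|₂², z = |ζ|₂², ι = X·ζ`, `R′ = |X+ζ|₂² ≥ ‖X‖∞²/4`.) [folklore] -/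
theorem taylor2_invSq (hX : X ≠ 0) (h : 2 * ‖ζ‖ ≤ ‖X‖) :
    |invSq (X + ζ) - invSq X - ∑ μ, ζ μ * d1InvSq μ X| ≤ 112 * ‖ζ‖ ^ 2 / ‖X‖ ^ 4 := by
  have hs : 0 < ‖X‖ := norm_pos_iff.mpr hX
  have hR : ‖X‖ ^ 2 ≤ r2 X := norm_sq_le_r2 X
  have hR4 : r2 X ≤ 4 * ‖X‖ ^ 2 := r2_le_four_mul X
  have hz0 : 0 ≤ r2 ζ := by rw [r2_eq_normSq]; exact normSq_nonneg ζ
  have hz4 : r2 ζ ≤ 4 * ‖ζ‖ ^ 2 := r2_le_four_mul ζ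
  have hζ0 : 0 ≤ ‖ζ‖ := norm_nonneg ζ
  have hzR : r2 ζ ≤ r2 X := by nlinarith
  have hι : ip X ζ ^ 2 ≤ r2 X * r2 ζ := ip_sq_le X ζ
  have hRpos : 0 < r2 X := lt_of_lt_of_le (by positivity) hR
  have hR' : r2 (X + ζ) = r2 X + 2 * ip X ζ + r2 ζ := r2_add X ζ
  have hR'low : ‖X‖ ^ 2 / 4 ≤ r2 X + 2 * ip X ζ + r2 ζ := by
    have h1 : ‖X + ζ‖ ^ 2 ≤ r2 (X + ζ) := norm_sq_le_r2 (X + ζ)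
    have h2 : (‖X‖ / 2) ^ 2 ≤ ‖X + ζ‖ ^ 2 := pow_le_pow_left₀ (by positivity) (half_norm_le_norm_add h) 2
    rw [hR'] at h1
    nlinarith
  have hR'pos : 0 < r2 X + 2 * ip X ζ + r2 ζ := lt_of_lt_of_le (by positivity) hR'low
  have hιR : |ip X ζ| ≤ r2 X := abs_le_of_sq_le_sq (by nlinarith) hRpos.le
  obtain ⟨hι1, hι2⟩ := abs_le.mp hιR
  have hA : 0 ≤ (r2 X - ip X ζ) * r2 ζ := mul_nonneg (by linarith) hz0
  have hB : 0 ≤ (r2 X + ip X ζ) * r2 ζ := mul_nonneg (by linarith) hz0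
  have hRz : 0 ≤ r2 X * r2 ζ := mul_nonneg hRpos.le hz0
  have e : invSq (X + ζ) - invSq X - ∑ μ, ζ μ * d1InvSq μ X =
      (4 * ip X ζ ^ 2 + 2 * ip X ζ * r2 ζ - r2 ζ * r2 X) / (r2 X ^ 2 * (r2 X + 2 * ip X ζ + r2 ζ)) := by
    rw [sum_mul_d1InvSq]
    simp only [invSq]
    rw [hR']
    field_simp
    ring
  rw [e, abs_div, abs_of_pos (by positivity : 0 < r2 X ^ 2 * (r2 X + 2 * ip X ζ + r2 ζ))]
  have hnum : |4 * ip X ζ ^ 2 + 2 * ip X ζ * r2 ζ - r2 ζ * r2 X| ≤ 7 * r2 X * r2 ζ := by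
    rw [abs_le]; constructor <;> nlinarith
  calc |4 * ip X ζ ^ 2 + 2 * ip X ζ * r2 ζ - r2 ζ * r2 X| / (r2 X ^ 2 * (r2 X + 2 * ip X ζ + r2 ζ))
      ≤ 7 * r2 X * r2 ζ / (r2 X ^ 2 * (r2 X + 2 * ip X ζ + r2 ζ)) := by gcongr
    _ = 7 * r2 ζ / (r2 X * (r2 X + 2 * ip X ζ + r2 ζ)) := by
        rw [show 7 * r2 X * r2 ζ = r2 X * (7 * r2 ζ) by ring,
          show r2 X ^ 2 * (r2 X + 2 * ip X ζ + r2 ζ) = r2 X * (r2 X * (r2 X + 2 * ip X ζ + r2 ζ)) by ring,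
          mul_div_mul_left _ _ hRpos.ne']
    _ ≤ 7 * (4 * ‖ζ‖ ^ 2) / (‖X‖ ^ 2 * (‖X‖ ^ 2 / 4)) := by gcongr
    _ = 112 * ‖ζ‖ ^ 2 / ‖X‖ ^ 4 := by field_simp; ring

/-- First-order consequence: `|1/|X+ζ|₂² − 1/|X|₂²| ≤ 64‖ζ‖∞/‖X‖∞³`. [folklore] -/
theorem taylor1_invSq (hX : X ≠ 0) (h : 2 * ‖ζ‖ ≤ ‖X‖) :
    |invSq (X + ζ) - invSq X| ≤ 64 * ‖ζ‖ / ‖X‖ ^ 3 := by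
  have hs : 0 < ‖X‖ := norm_pos_iff.mpr hX
  have hζ0 : 0 ≤ ‖ζ‖ := norm_nonneg ζ
  have hR : ‖X‖ ^ 2 ≤ r2 X := norm_sq_le_r2 X
  have hRpos : 0 < r2 X := lt_of_lt_of_le (by positivity) hR
  have h2 := taylor2_invSq hX h
  have hlin : |∑ μ, ζ μ * d1InvSq μ X| ≤ 8 * ‖ζ‖ / ‖X‖ ^ 3 := by
    rw [sum_mul_d1InvSq, abs_div, abs_of_pos (by positivity : 0 < r2 X ^ 2), abs_mul, abs_neg, abs_two]
    calc 2 * |ip X ζ| / r2 X ^ 2 ≤ 2 * (4 * ‖X‖ * ‖ζ‖) / (‖X‖ ^ 2) ^ 2 := by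
          gcongr
          exact abs_ip_le X ζ
      _ = 8 * ‖ζ‖ / ‖X‖ ^ 3 := by field_simp; ring
  have hq : 112 * ‖ζ‖ ^ 2 / ‖X‖ ^ 4 ≤ 56 * ‖ζ‖ / ‖X‖ ^ 3 := by
    rw [div_le_div_iff₀ (by positivity) (by positivity)]
    have : ‖ζ‖ * ‖X‖ ^ 3 * (2 * ‖ζ‖) ≤ ‖ζ‖ * ‖X‖ ^ 3 * ‖X‖ := mul_le_mul_of_nonneg_left h (by positivity)
    nlinarith
  calc |invSq (X + ζ) - invSq X|
      = |(invSq (X + ζ) - invSq X - ∑ μ, ζ μ * d1InvSq μ X) + ∑ μ, ζ μ * d1InvSq μ X| := by ring_nf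
    _ ≤ |invSq (X + ζ) - invSq X - ∑ μ, ζ μ * d1InvSq μ X| + |∑ μ, ζ μ * d1InvSq μ X| := abs_add_le _ _
    _ ≤ 112 * ‖ζ‖ ^ 2 / ‖X‖ ^ 4 + 8 * ‖ζ‖ / ‖X‖ ^ 3 := add_le_add h2 hlin
    _ ≤ 56 * ‖ζ‖ / ‖X‖ ^ 3 + 8 * ‖ζ‖ / ‖X‖ ^ 3 := by linarith
    _ = 64 * ‖ζ‖ / ‖X‖ ^ 3 := by ring

/-- **THIRD-ORDER TAYLOR BOUND FOR `|x|⁻²`**: for `X ≠ 0`, `2‖ζ‖∞ ≤ ‖X‖∞`,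
`|1/|X+ζ|₂² − 1/|X|₂² − Σ ζ_μ∂_μ|X|⁻² − ½Σ ζ_aζ_b∂_a∂_b|X|⁻²| ≤ 3712‖ζ‖∞³/‖X‖∞⁵`.  (Exact numerator
`4ιzR + z²R − 8ι³ − 4ι²z` over `R³R′`.) [folklore] -/
theorem taylor3_invSq (hX : X ≠ 0) (h : 2 * ‖ζ‖ ≤ ‖X‖) :
    |invSq (X + ζ) - invSq X - ∑ μ, ζ μ * d1InvSq μ X - (1 / 2) * ∑ a, ∑ b, ζ a * ζ b * hessInvSq a b X| ≤
      3712 * ‖ζ‖ ^ 3 / ‖X‖ ^ 5 := by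
  have hs : 0 < ‖X‖ := norm_pos_iff.mpr hX
  have hζ0 : 0 ≤ ‖ζ‖ := norm_nonneg ζ
  have hR : ‖X‖ ^ 2 ≤ r2 X := norm_sq_le_r2 X
  have hR4 : r2 X ≤ 4 * ‖X‖ ^ 2 := r2_le_four_mul X
  have hz0 : 0 ≤ r2 ζ := by rw [r2_eq_normSq]; exact normSq_nonneg ζ
  have hz4 : r2 ζ ≤ 4 * ‖ζ‖ ^ 2 := r2_le_four_mul ζ
  have hιabs : |ip X ζ| ≤ 4 * ‖X‖ * ‖ζ‖ := abs_ip_le X ζ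
  have hRpos : 0 < r2 X := lt_of_lt_of_le (by positivity) hR
  have hR' : r2 (X + ζ) = r2 X + 2 * ip X ζ + r2 ζ := r2_add X ζ
  have hR'low : ‖X‖ ^ 2 / 4 ≤ r2 X + 2 * ip X ζ + r2 ζ := by
    have h1 : ‖X + ζ‖ ^ 2 ≤ r2 (X + ζ) := norm_sq_le_r2 (X + ζ)
    have h2 : (‖X‖ / 2) ^ 2 ≤ ‖X + ζ‖ ^ 2 := pow_le_pow_left₀ (by positivity) (half_norm_le_norm_add h) 2
    rw [hR'] at h1
    nlinarith
  have hR'pos : 0 < r2 X + 2 * ip X ζ + r2 ζ := lt_of_lt_of_le (by positivity) hR'low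
  have e : invSq (X + ζ) - invSq X - ∑ μ, ζ μ * d1InvSq μ X - (1 / 2) * ∑ a, ∑ b, ζ a * ζ b * hessInvSq a b X =
      (4 * ip X ζ * r2 ζ * r2 X + r2 ζ ^ 2 * r2 X - 8 * ip X ζ ^ 3 - 4 * ip X ζ ^ 2 * r2 ζ) /
        (r2 X ^ 3 * (r2 X + 2 * ip X ζ + r2 ζ)) := by
    rw [sum_mul_d1InvSq, sum_sum_mul_hessInvSq]
    simp only [invSq]
    rw [hR']
    field_simp
    ring
  rw [e, abs_div, abs_of_pos (by positivity : 0 < r2 X ^ 3 * (r2 X + 2 * ip X ζ + r2 ζ))]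
  -- the numerator
  have hN : |4 * ip X ζ * r2 ζ * r2 X + r2 ζ ^ 2 * r2 X - 8 * ip X ζ ^ 3 - 4 * ip X ζ ^ 2 * r2 ζ| ≤
      4 * |ip X ζ| * r2 ζ * r2 X + r2 ζ ^ 2 * r2 X + 8 * |ip X ζ| ^ 3 + 4 * |ip X ζ| ^ 2 * r2 ζ := by
    have e1 : |4 * ip X ζ * r2 ζ * r2 X| = 4 * |ip X ζ| * r2 ζ * r2 X := by
      rw [abs_mul, abs_mul, abs_mul, abs_of_nonneg hz0, abs_of_nonneg hRpos.le]; norm_num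
    have e2 : |r2 ζ ^ 2 * r2 X| = r2 ζ ^ 2 * r2 X := abs_of_nonneg (by positivity)
    have e3 : |8 * ip X ζ ^ 3| = 8 * |ip X ζ| ^ 3 := by rw [abs_mul, abs_pow]; norm_num
    have e4 : |4 * ip X ζ ^ 2 * r2 ζ| = 4 * |ip X ζ| ^ 2 * r2 ζ := by
      rw [abs_mul, abs_mul, abs_pow, abs_of_nonneg hz0]; norm_num
    calc |4 * ip X ζ * r2 ζ * r2 X + r2 ζ ^ 2 * r2 X - 8 * ip X ζ ^ 3 - 4 * ip X ζ ^ 2 * r2 ζ|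
        ≤ |4 * ip X ζ * r2 ζ * r2 X + r2 ζ ^ 2 * r2 X - 8 * ip X ζ ^ 3| + |4 * ip X ζ ^ 2 * r2 ζ| :=
          abs_sub _ _
      _ ≤ (|4 * ip X ζ * r2 ζ * r2 X + r2 ζ ^ 2 * r2 X| + |8 * ip X ζ ^ 3|) + |4 * ip X ζ ^ 2 * r2 ζ| := by
          gcongr; exact abs_sub _ _
      _ ≤ ((|4 * ip X ζ * r2 ζ * r2 X| + |r2 ζ ^ 2 * r2 X|) + |8 * ip X ζ ^ 3|) + |4 * ip X ζ ^ 2 * r2 ζ| := by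
          gcongr; exact abs_add_le _ _
      _ = 4 * |ip X ζ| * r2 ζ * r2 X + r2 ζ ^ 2 * r2 X + 8 * |ip X ζ| ^ 3 + 4 * |ip X ζ| ^ 2 * r2 ζ := by
          rw [e1, e2, e3, e4]
  have hι0 : 0 ≤ |ip X ζ| := abs_nonneg _
  have hN2 : 4 * |ip X ζ| * r2 ζ * r2 X + r2 ζ ^ 2 * r2 X + 8 * |ip X ζ| ^ 3 + 4 * |ip X ζ| ^ 2 * r2 ζ ≤
      4 * (4 * ‖X‖ * ‖ζ‖) * (4 * ‖ζ‖ ^ 2) * (4 * ‖X‖ ^ 2) + (4 * ‖ζ‖ ^ 2) ^ 2 * (4 * ‖X‖ ^ 2) +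
        8 * (4 * ‖X‖ * ‖ζ‖) ^ 3 + 4 * (4 * ‖X‖ * ‖ζ‖) ^ 2 * (4 * ‖ζ‖ ^ 2) := by
    gcongr
  have hts : ‖ζ‖ ≤ ‖X‖ / 2 := by linarith
  have hkey : ‖X‖ ^ 2 * ‖ζ‖ ^ 4 ≤ ‖X‖ ^ 3 * ‖ζ‖ ^ 3 / 2 := by
    have : ‖X‖ ^ 3 * ‖ζ‖ ^ 3 / 2 - ‖X‖ ^ 2 * ‖ζ‖ ^ 4 = ‖X‖ ^ 2 * ‖ζ‖ ^ 3 * (‖X‖ / 2 - ‖ζ‖) := by ring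
    nlinarith [mul_nonneg (mul_nonneg (pow_nonneg hs.le 2) (pow_nonneg hζ0 3)) (sub_nonneg.mpr hts)]
  have hN3 : 4 * (4 * ‖X‖ * ‖ζ‖) * (4 * ‖ζ‖ ^ 2) * (4 * ‖X‖ ^ 2) + (4 * ‖ζ‖ ^ 2) ^ 2 * (4 * ‖X‖ ^ 2) +
        8 * (4 * ‖X‖ * ‖ζ‖) ^ 3 + 4 * (4 * ‖X‖ * ‖ζ‖) ^ 2 * (4 * ‖ζ‖ ^ 2) ≤ 928 * ‖X‖ ^ 3 * ‖ζ‖ ^ 3 := by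
    nlinarith
  calc |4 * ip X ζ * r2 ζ * r2 X + r2 ζ ^ 2 * r2 X - 8 * ip X ζ ^ 3 - 4 * ip X ζ ^ 2 * r2 ζ| /
        (r2 X ^ 3 * (r2 X + 2 * ip X ζ + r2 ζ))
      ≤ 928 * ‖X‖ ^ 3 * ‖ζ‖ ^ 3 / (r2 X ^ 3 * (r2 X + 2 * ip X ζ + r2 ζ)) := by
        gcongr
        exact hN.trans (hN2.trans hN3)
    _ ≤ 928 * ‖X‖ ^ 3 * ‖ζ‖ ^ 3 / ((‖X‖ ^ 2) ^ 3 * (‖X‖ ^ 2 / 4)) := by gcongr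
    _ = 3712 * ‖ζ‖ ^ 3 / ‖X‖ ^ 5 := by field_simp; ring

/-- **POLARISATION of a symmetric quadratic form**: `Q(u+v) − Q(u) − Q(v) = 2B(u,v)`. [folklore] -/
theorem quad_polar (H : Fin 4 → Fin 4 → ℝ) (hs : ∀ a b, H a b = H b a) (u v : E4) :
    ∑ a, ∑ b, (u + v) a * (u + v) b * H a b - ∑ a, ∑ b, u a * u b * H a b - ∑ a, ∑ b, v a * v b * H a b =
      2 * ∑ a, ∑ b, u a * v b * H a b := by
  have hswap : ∑ a, ∑ b, v a * u b * H a b = ∑ a, ∑ b, u a * v b * H a b := by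
    rw [Finset.sum_comm]
    exact Finset.sum_congr rfl fun a _ => Finset.sum_congr rfl fun b _ => by rw [hs b a]; ring
  have e : ∀ a b, (u + v) a * (u + v) b * H a b =
      u a * u b * H a b + u a * v b * H a b + v a * u b * H a b + v a * v b * H a b := by
    intro a b; simp only [Pi.add_apply]; ring
  simp_rw [e, Finset.sum_add_distrib]
  rw [hswap]
  ring

end Taylor

/-! ## §2. The input shape (F1)+(F2) and the undifferentiated / gradient legs it yields -/

/-- **THE INPUT OF THE ADAPTER**: a propagator family `g L k : ℤ⁴ → ℝ` whose undifferentiated asymptotics are TWO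
powers better than the leading `c₄|v|₂⁻²` — (F1) `|g L k v − c₄/|v|₂²| ≤ B/‖v‖∞⁴` (`v ≠ 0`) — and which is uniformly
bounded — (F2) `|g L k v| ≤ U` (all `v`) — with `B, U` FREE of `(L,k)`.  A structure carrying data and two proved
inequalities; it asserts nothing by itself. [folklore] -/
structure TwoPower where
  /-- the family, per `(L,k)` -/
  g : ℕ → ℕ → Pt → ℝ
  /-- the two-powers-better error constant -/
  B : ℝ
  /-- the uniform sup bound -/
  U : ℝ
  nonneg_B : 0 ≤ B
  nonneg_U : 0 ≤ U
  err4 : ∀ L k : ℕ, ∀ v : Pt, v ≠ 0 → |g L k v - c4 * invSq (toReal v)| ≤ B / (supNorm v : ℝ) ^ 4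
  bdd : ∀ L k : ℕ, ∀ v : Pt, |g L k v| ≤ U

/-- `0 < ‖w‖∞` (real cast) for `w ≠ 0`. [folklore] -/
theorem supNorm_cast_pos {w : Pt} (hw : w ≠ 0) : (0 : ℝ) < supNorm w := by
  exact_mod_cast supNorm_pos hw

/-- `toReal` is compatible with negation. [folklore] -/
theorem toReal_neg (w : Pt) : toReal (-w) = -toReal w := by
  ext i; simp [toReal]

/-- Reverse triangle inequality on `ℤ⁴`: `‖w‖∞ − ‖α‖∞ ≤ ‖w + α‖∞`. [folklore] -/
theorem supNorm_sub_le_supNorm_add (w α : Pt) : (supNorm w : ℝ) - supNorm α ≤ supNorm (w + α) := by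
  rw [← norm_toReal, ← norm_toReal, ← norm_toReal, toReal_add]
  have := norm_sub_le (toReal w + toReal α) (toReal α)
  rw [add_sub_cancel_right] at this
  linarith

/-- `‖e_μ‖∞ = 1`. [folklore] -/
theorem supNorm_unitVec (μ : Fin 4) : supNorm (unitVec μ) = 1 := by
  revert μ; decide

/-- `‖−e_μ‖∞ = 1`. [folklore] -/
theorem supNorm_neg_unitVec (μ : Fin 4) : supNorm (-unitVec μ) = 1 := by
  revert μ; decide

/-- `‖e_μ + e_ν‖∞ = 1` for `μ ≠ ν`. [folklore] -/
theorem supNorm_unitVec_add {μ ν : Fin 4} (hμν : μ ≠ ν) : supNorm (unitVec μ + unitVec ν) = 1 := by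
  revert μ ν; decide

/-- Contraction against `e_μ` picks the `μ`-th component. [folklore] -/
theorem sum_toReal_unitVec_mul (μ : Fin 4) (F : Fin 4 → ℝ) : ∑ ν, toReal (unitVec μ) ν * F ν = F μ := by
  simp [unitVec, toReal, Pi.single_apply, Finset.sum_ite_eq']

/-- Contraction against `−e_μ`. [folklore] -/
theorem sum_toReal_neg_unitVec_mul (μ : Fin 4) (F : Fin 4 → ℝ) :
    ∑ ν, toReal (-unitVec μ) ν * F ν = -F μ := by
  rw [toReal_neg, ← sum_toReal_unitVec_mul μ F, ← Finset.sum_neg_distrib]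
  exact Finset.sum_congr rfl fun ν _ => by simp

/-- Double contraction against `e_ν, e_μ` picks the `(ν, μ)` entry. [folklore] -/
theorem sum_sum_toReal_unitVec_mul (μ ν : Fin 4) (H : Fin 4 → Fin 4 → ℝ) :
    ∑ a, ∑ b, toReal (unitVec ν) a * toReal (unitVec μ) b * H a b = H ν μ := by
  have e : ∀ a, ∑ b, toReal (unitVec ν) a * toReal (unitVec μ) b * H a b =
      toReal (unitVec ν) a * ∑ b, toReal (unitVec μ) b * H a b := by
    intro a; rw [Finset.mul_sum]; exact Finset.sum_congr rfl fun b _ => by ring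
  simp_rw [e, sum_toReal_unitVec_mul]

namespace TwoPower

variable (T : TwoPower)

/-- **THE UNDIFFERENTIATED LEG**: `f = g`, continuum part `c₄|x|⁻²`, degree `2`, `A = c₄`, `B = T.B` (the two-powers
bound weakened to one power). [folklore] -/
def baseLeg : Leg where
  f := T.g
  ℓ x := c4 * invSq x
  a := 2
  A := c4
  B := T.B
  nonneg_A := c4_pos.le
  nonneg_B := T.nonneg_B
  lead w hw := freeLeg.lead w hw
  err L k w hw := by
    have hs : (1 : ℝ) ≤ supNorm w := Leg.one_le_supNorm hw
    refine (T.err4 L k w hw).trans (div_le_div_of_nonneg_left T.nonneg_B (by positivity) ?_)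
    exact pow_le_pow_right₀ hs (by norm_num)

/-- unfolding. [folklore] -/
@[simp] theorem baseLeg_f : T.baseLeg.f = T.g := rfl
/-- unfolding. [folklore] -/
@[simp] theorem baseLeg_ℓ (x : E4) : T.baseLeg.ℓ x = c4 * invSq x := rfl
/-- unfolding. [folklore] -/
@[simp] theorem baseLeg_a : T.baseLeg.a = 2 := rfl

/-- **THE INCREMENT BOUND** (far field): for a lattice shift `α` with `‖α‖∞ ≤ r`, `1 ≤ r`, `2r ≤ ‖w‖∞`,
`|g(w+α) − g(w) − c₄ Σ α_ν∂_ν|w|⁻²| ≤ (17B + 112c₄r²)/‖w‖∞⁴`. [folklore] -/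
theorem incr_bound (L k : ℕ) {w α : Pt} {r : ℕ} (hα : supNorm α ≤ r) (hr : 1 ≤ r) (hw : 2 * r ≤ supNorm w) :
    |T.g L k (w + α) - T.g L k w - c4 * ∑ ν, toReal α ν * d1InvSq ν (toReal w)| ≤
      (17 * T.B + 112 * c4 * (r : ℝ) ^ 2) / (supNorm w : ℝ) ^ 4 := by
  have hr' : (1 : ℝ) ≤ r := by exact_mod_cast hr
  have hsw : 2 * (r : ℝ) ≤ supNorm w := by exact_mod_cast hw
  have hs2 : (2 : ℝ) ≤ supNorm w := by linarith
  have hw0 : w ≠ 0 := by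
    intro h; have h0 := supNorm_eq_zero_iff.mpr h; omega
  have hα' : (supNorm α : ℝ) ≤ r := by exact_mod_cast hα
  have hwa : (supNorm w : ℝ) / 2 ≤ supNorm (w + α) := by
    have := supNorm_sub_le_supNorm_add w α; linarith
  have hwa1 : (1 : ℝ) ≤ supNorm (w + α) := by linarith
  have hwa0 : w + α ≠ 0 := by
    intro h; have h0 := supNorm_eq_zero_iff.mpr h; rw [h0] at hwa1; norm_num at hwa1
  have hX0 : toReal w ≠ 0 := fun h => hw0 (toReal_eq_zero_iff.mp h)
  have hζ : 2 * ‖toReal α‖ ≤ ‖toReal w‖ := by rw [norm_toReal, norm_toReal]; linarith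
  have h1 := T.err4 L k (w + α) hwa0
  have h2 := T.err4 L k w hw0
  have h3 := taylor2_invSq hX0 hζ
  rw [norm_toReal, norm_toReal] at h3
  rw [toReal_add] at h1
  have hspos : (0 : ℝ) < supNorm w := by linarith
  have h1' : T.B / (supNorm (w + α) : ℝ) ^ 4 ≤ 16 * T.B / (supNorm w : ℝ) ^ 4 := by
    rw [div_le_div_iff₀ (by positivity) (by positivity)]
    have : ((supNorm w : ℝ) / 2) ^ 4 ≤ (supNorm (w + α) : ℝ) ^ 4 := pow_le_pow_left₀ (by positivity) hwa 4
    nlinarith [T.nonneg_B]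
  have h3' : 112 * (supNorm α : ℝ) ^ 2 / (supNorm w : ℝ) ^ 4 ≤ 112 * (r : ℝ) ^ 2 / (supNorm w : ℝ) ^ 4 := by
    gcongr
  have e : T.g L k (w + α) - T.g L k w - c4 * ∑ ν, toReal α ν * d1InvSq ν (toReal w) =
      (T.g L k (w + α) - c4 * invSq (toReal w + toReal α)) - (T.g L k w - c4 * invSq (toReal w)) +
        c4 * (invSq (toReal w + toReal α) - invSq (toReal w) - ∑ ν, toReal α ν * d1InvSq ν (toReal w)) := by
    ring
  rw [e]
  calc |(T.g L k (w + α) - c4 * invSq (toReal w + toReal α)) - (T.g L k w - c4 * invSq (toReal w)) +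
          c4 * (invSq (toReal w + toReal α) - invSq (toReal w) - ∑ ν, toReal α ν * d1InvSq ν (toReal w))|
      ≤ |(T.g L k (w + α) - c4 * invSq (toReal w + toReal α)) - (T.g L k w - c4 * invSq (toReal w))| +
          |c4 * (invSq (toReal w + toReal α) - invSq (toReal w) - ∑ ν, toReal α ν * d1InvSq ν (toReal w))| :=
        abs_add_le _ _
    _ ≤ (|T.g L k (w + α) - c4 * invSq (toReal w + toReal α)| + |T.g L k w - c4 * invSq (toReal w)|) +
          c4 * |invSq (toReal w + toReal α) - invSq (toReal w) - ∑ ν, toReal α ν * d1InvSq ν (toReal w)| := by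
        rw [abs_mul, abs_of_pos c4_pos]
        gcongr
        exact abs_sub _ _
    _ ≤ (16 * T.B / (supNorm w : ℝ) ^ 4 + T.B / (supNorm w : ℝ) ^ 4) + c4 * (112 * (r : ℝ) ^ 2 / (supNorm w : ℝ) ^ 4) := by
        gcongr
        · exact h1.trans h1'
        · exact c4_pos.le
        · exact h3.trans h3'
    _ = (17 * T.B + 112 * c4 * (r : ℝ) ^ 2) / (supNorm w : ℝ) ^ 4 := by ring

/-- The gradient legs' error constant. [folklore] -/
def Bgrad : ℝ := 17 * T.B + 112 * c4 + 2 * T.U + 2 * c4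

/-- `0 ≤ Bgrad`. [folklore] -/
theorem Bgrad_nonneg : 0 ≤ T.Bgrad := by
  have := T.nonneg_B; have := T.nonneg_U; have := c4_pos.le
  unfold Bgrad; positivity

/-- The gradient error in both regimes, for a unit shift `α` (`‖α‖∞ = 1`) with contraction value `c₄ d`:
`|g(w+α) − g(w) − c₄d| ≤ Bgrad/‖w‖∞⁴` whenever `|c₄ d| ≤ 2c₄/‖w‖∞³`. [folklore] -/
theorem shift_err (L k : ℕ) {w α : Pt} (hw : w ≠ 0) (hα : supNorm α = 1) {d : ℝ}
    (hd : c4 * ∑ ν, toReal α ν * d1InvSq ν (toReal w) = c4 * d) (hlead : |c4 * d| ≤ 2 * c4 / (supNorm w : ℝ) ^ 3) :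
    |T.g L k (w + α) - T.g L k w - c4 * d| ≤ T.Bgrad / (supNorm w : ℝ) ^ 4 := by
  have hs : (1 : ℝ) ≤ supNorm w := Leg.one_le_supNorm hw
  have hspos : (0 : ℝ) < supNorm w := by linarith
  rcases le_or_gt 2 (supNorm w) with h2 | h2
  · have h := T.incr_bound L k (α := α) (r := 1) (by rw [hα]) le_rfl (by simpa using h2)
    rw [hd] at h
    refine h.trans ?_
    rw [div_le_div_iff₀ (by positivity) (by positivity)]
    have : 17 * T.B + 112 * c4 * (1 : ℕ) ^ 2 ≤ T.Bgrad := by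
      simp [Bgrad]; nlinarith [T.nonneg_U, c4_pos]
    nlinarith [pow_pos hspos 4]
  · have hs1 : supNorm w = 1 := by have := supNorm_pos hw; omega
    have hs1' : (supNorm w : ℝ) = 1 := by exact_mod_cast hs1
    rw [hs1'] at hlead ⊢
    simp only [one_pow, div_one] at hlead ⊢
    have hb1 := T.bdd L k (w + α)
    have hb2 := T.bdd L k w
    calc |T.g L k (w + α) - T.g L k w - c4 * d| ≤ |T.g L k (w + α) - T.g L k w| + |c4 * d| := abs_sub _ _
      _ ≤ (|T.g L k (w + α)| + |T.g L k w|) + |c4 * d| := by gcongr; exact abs_sub _ _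
      _ ≤ (T.U + T.U) + 2 * c4 := by gcongr
      _ ≤ T.Bgrad := by unfold Bgrad; nlinarith [T.nonneg_B, c4_pos]

/-- **THE FORWARD-GRADIENT LEG** `f = g(·+e_μ) − g`, continuum part `c₄∂_μ|x|⁻²`, degree `3`, `A = 2c₄`,
`B = 17B + 112c₄ + 2U + 2c₄`. [folklore] -/
def fwdLeg (μ : Fin 4) : Leg where
  f L k w := T.g L k (w + unitVec μ) - T.g L k w
  ℓ x := c4 * d1InvSq μ x
  a := 3
  A := 2 * c4
  B := T.Bgrad
  nonneg_A := mul_nonneg (by norm_num) c4_pos.le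
  nonneg_B := T.Bgrad_nonneg
  lead w hw := abs_grad_cont_le μ hw
  err L k w hw := T.shift_err L k hw (supNorm_unitVec μ) (by rw [sum_toReal_unitVec_mul]) (abs_grad_cont_le μ hw)

/-- **THE BACKWARD-GRADIENT LEG** `f = g − g(·−e_μ)`, same continuum part and constants. [folklore] -/
def bwdLeg (μ : Fin 4) : Leg where
  f L k w := T.g L k w - T.g L k (w - unitVec μ)
  ℓ x := c4 * d1InvSq μ x
  a := 3
  A := 2 * c4
  B := T.Bgrad
  nonneg_A := mul_nonneg (by norm_num) c4_pos.le
  nonneg_B := T.Bgrad_nonneg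
  lead w hw := abs_grad_cont_le μ hw
  err L k w hw := by
    have h := T.shift_err L k hw (supNorm_neg_unitVec μ) (d := -d1InvSq μ (toReal w))
      (by rw [sum_toReal_neg_unitVec_mul]) (by rw [mul_neg, abs_neg]; exact abs_grad_cont_le μ hw)
    have e : T.g L k w - T.g L k (w - unitVec μ) - c4 * d1InvSq μ (toReal w) =
        -(T.g L k (w + -unitVec μ) - T.g L k w - c4 * -d1InvSq μ (toReal w)) := by
      rw [← sub_eq_add_neg]; ring
    rw [e, abs_neg]
    exact h

/-- unfolding. [folklore] -/
@[simp] theorem fwdLeg_ℓ (μ : Fin 4) (x : E4) : (T.fwdLeg μ).ℓ x = c4 * d1InvSq μ x := rfl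
/-- unfolding. [folklore] -/
@[simp] theorem bwdLeg_ℓ (μ : Fin 4) (x : E4) : (T.bwdLeg μ).ℓ x = c4 * d1InvSq μ x := rfl
/-- unfolding. [folklore] -/
@[simp] theorem fwdLeg_a (μ : Fin 4) : (T.fwdLeg μ).a = 3 := rfl
/-- unfolding. [folklore] -/
@[simp] theorem bwdLeg_a (μ : Fin 4) : (T.bwdLeg μ).a = 3 := rfl
/-- unfolding. [folklore] -/
@[simp] theorem fwdLeg_f (μ : Fin 4) (L k : ℕ) (w : Pt) :
    (T.fwdLeg μ).f L k w = T.g L k (w + unitVec μ) - T.g L k w := rfl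

/-! ### §2b (v1.1). TRANSLATED and DIFFERENCED legs for a bounded lattice shift `α` (an2-g3 NOTE 23:06:25Z (2)) -/

/-- The contraction `c₄α·∇|x|⁻²` at lattice points: `|c₄Σ_ν α_ν∂_ν|w|⁻²| ≤ 8c₄r/‖w‖∞³` for `‖α‖∞ ≤ r`. [folklore] -/
theorem abs_sum_grad_cont_le {α : Pt} {r : ℕ} (hα : supNorm α ≤ r) {w : Pt} (hw : w ≠ 0) :
    |c4 * ∑ ν, toReal α ν * d1InvSq ν (toReal w)| ≤ 8 * c4 * r / (supNorm w : ℝ) ^ 3 := by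
  have hα' : (supNorm α : ℝ) ≤ r := by exact_mod_cast hα
  have hco : ∀ ν, |toReal α ν| ≤ r := fun ν =>
    ((abs_apply_le_norm (toReal α) ν).trans (le_of_eq (norm_toReal α))).trans hα'
  rw [Finset.mul_sum]
  calc |∑ ν, c4 * (toReal α ν * d1InvSq ν (toReal w))|
      ≤ ∑ ν, |c4 * (toReal α ν * d1InvSq ν (toReal w))| := Finset.abs_sum_le_sum_abs _ _
    _ = ∑ ν, |toReal α ν| * |c4 * d1InvSq ν (toReal w)| :=
        Finset.sum_congr rfl fun ν _ => by rw [abs_mul, abs_mul, abs_mul]; ring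
    _ ≤ ∑ _ν : Fin 4, (r : ℝ) * (2 * c4 / (supNorm w : ℝ) ^ 3) :=
        Finset.sum_le_sum fun ν _ => mul_le_mul (hco ν) (abs_grad_cont_le ν hw) (abs_nonneg _) (Nat.cast_nonneg r)
    _ = 8 * c4 * r / (supNorm w : ℝ) ^ 3 := by
        rw [Finset.sum_const, Finset.card_univ, Fintype.card_fin, nsmul_eq_mul]; push_cast; ring

/-- The translate's error constant: `18B + 112c₄r² + 8c₄r + 8(U + c₄)r³`. [folklore] -/
def Bshift (r : ℕ) : ℝ := 18 * T.B + 112 * c4 * (r : ℝ) ^ 2 + 8 * c4 * r + 8 * (T.U + c4) * (r : ℝ) ^ 3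

/-- **TRANSLATED LEG**: for `‖α‖∞ ≤ r`, `1 ≤ r`, `w ↦ g(w + α)` is a `Leg` with continuum part `c₄/|x|₂²`, degree `2`,
`A = c₄`, `B = Bshift r` — ONE power better only (the gradient term `c₄α·∇|w|⁻²` is of size `8c₄r/‖w‖∞³`), which is
what `Leg` asks.  Constants free of `(L,k)`. [folklore] -/
def shiftLeg {α : Pt} {r : ℕ} (hα : supNorm α ≤ r) (hr : 1 ≤ r) : Leg where
  f L k w := T.g L k (w + α)
  ℓ x := c4 * invSq x
  a := 2
  A := c4
  B := T.Bshift r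
  nonneg_A := c4_pos.le
  nonneg_B := by have := T.nonneg_B; have := T.nonneg_U; have := c4_pos.le; unfold Bshift; positivity
  lead w hw := freeLeg.lead w hw
  err L k w hw := by
    have hs : (1 : ℝ) ≤ supNorm w := Leg.one_le_supNorm hw
    have hspos : (0 : ℝ) < supNorm w := by linarith
    have hr' : (1 : ℝ) ≤ r := by exact_mod_cast hr
    have hB := T.nonneg_B; have hU := T.nonneg_U; have hc := c4_pos.le
    rcases le_or_gt (2 * r) (supNorm w) with hfar | hnear
    · have h1 := T.incr_bound L k hα hr hfar
      have h2 := T.err4 L k w hw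
      have h3 := abs_sum_grad_cont_le hα hw
      have e : T.g L k (w + α) - c4 * invSq (toReal w) =
          (T.g L k (w + α) - T.g L k w - c4 * ∑ ν, toReal α ν * d1InvSq ν (toReal w)) +
          (T.g L k w - c4 * invSq (toReal w)) + c4 * ∑ ν, toReal α ν * d1InvSq ν (toReal w) := by ring
      rw [e]
      have hsplit : |(T.g L k (w + α) - T.g L k w - c4 * ∑ ν, toReal α ν * d1InvSq ν (toReal w)) +
          (T.g L k w - c4 * invSq (toReal w)) + c4 * ∑ ν, toReal α ν * d1InvSq ν (toReal w)| ≤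
          (17 * T.B + 112 * c4 * (r : ℝ) ^ 2) / (supNorm w : ℝ) ^ 4 + T.B / (supNorm w : ℝ) ^ 4 +
          8 * c4 * r / (supNorm w : ℝ) ^ 3 := by
        have hk1 := abs_add_le ((T.g L k (w + α) - T.g L k w - c4 * ∑ ν, toReal α ν * d1InvSq ν (toReal w)) +
          (T.g L k w - c4 * invSq (toReal w))) (c4 * ∑ ν, toReal α ν * d1InvSq ν (toReal w))
        have hk2 := abs_add_le (T.g L k (w + α) - T.g L k w - c4 * ∑ ν, toReal α ν * d1InvSq ν (toReal w))
          (T.g L k w - c4 * invSq (toReal w))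
        linarith
      refine hsplit.trans ?_
      have hs3 : (supNorm w : ℝ) ^ 3 ≤ (supNorm w : ℝ) ^ 4 := by
        rw [pow_succ]; exact le_mul_of_one_le_right (by positivity) hs
      have k1 : (17 * T.B + 112 * c4 * (r : ℝ) ^ 2) / (supNorm w : ℝ) ^ 4 ≤
          (17 * T.B + 112 * c4 * (r : ℝ) ^ 2) / (supNorm w : ℝ) ^ 3 :=
        div_le_div_of_nonneg_left (by positivity) (by positivity) hs3
      have k2 : T.B / (supNorm w : ℝ) ^ 4 ≤ T.B / (supNorm w : ℝ) ^ 3 :=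
        div_le_div_of_nonneg_left hB (by positivity) hs3
      have k3 : (17 * T.B + 112 * c4 * (r : ℝ) ^ 2) / (supNorm w : ℝ) ^ 3 + T.B / (supNorm w : ℝ) ^ 3 +
          8 * c4 * r / (supNorm w : ℝ) ^ 3 ≤ T.Bshift r / (supNorm w : ℝ) ^ (2 + 1) := by
        rw [show (2 + 1 : ℕ) = 3 by norm_num, ← add_div, ← add_div]
        refine div_le_div_of_nonneg_right ?_ (by positivity)
        unfold Bshift
        have : 0 ≤ 8 * (T.U + c4) * (r : ℝ) ^ 3 := by positivity
        linarith
      linarith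
    · have ht : (supNorm w : ℝ) < 2 * r := by exact_mod_cast hnear
      have hpow : (supNorm w : ℝ) ^ 3 ≤ (2 * (r : ℝ)) ^ 3 := pow_le_pow_left₀ hspos.le ht.le 3
      have h1 := T.bdd L k (w + α)
      have h2 : |c4 * invSq (toReal w)| ≤ c4 := (freeLeg.lead w hw).trans (div_le_self hc (one_le_pow₀ hs))
      calc |T.g L k (w + α) - c4 * invSq (toReal w)| ≤ T.U + c4 := (abs_sub _ _).trans (add_le_add h1 h2)
        _ = (T.U + c4) * (supNorm w : ℝ) ^ 3 / (supNorm w : ℝ) ^ (2 + 1) := by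
            rw [show (2 + 1 : ℕ) = 3 by norm_num]; field_simp
        _ ≤ T.Bshift r / (supNorm w : ℝ) ^ (2 + 1) := by
            refine div_le_div_of_nonneg_right ?_ (by positivity)
            unfold Bshift
            nlinarith [mul_le_mul_of_nonneg_left hpow (add_nonneg hU hc)]

/-- unfolding. [folklore] -/
@[simp] theorem shiftLeg_f {α : Pt} {r : ℕ} (hα : supNorm α ≤ r) (hr : 1 ≤ r) (L k : ℕ) (w : Pt) :
    (T.shiftLeg hα hr).f L k w = T.g L k (w + α) := rfl
/-- unfolding. [folklore] -/
@[simp] theorem shiftLeg_ℓ {α : Pt} {r : ℕ} (hα : supNorm α ≤ r) (hr : 1 ≤ r) (x : E4) :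
    (T.shiftLeg hα hr).ℓ x = c4 * invSq x := rfl
/-- unfolding. [folklore] -/
@[simp] theorem shiftLeg_a {α : Pt} {r : ℕ} (hα : supNorm α ≤ r) (hr : 1 ≤ r) : (T.shiftLeg hα hr).a = 2 := rfl

/-- The differenced leg's error constant: `17B + 112c₄r² + 16(2U + 8c₄r)r⁴`. [folklore] -/
def Bdiff (r : ℕ) : ℝ := 17 * T.B + 112 * c4 * (r : ℝ) ^ 2 + 16 * (2 * T.U + 8 * c4 * r) * (r : ℝ) ^ 4

/-- **DIFFERENCED LEG** along a bounded shift: for `‖α‖∞ ≤ r`, `1 ≤ r`, `w ↦ g(w + α) − g(w)` is a `Leg` with continuum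
part `c₄α·∇|x|⁻² = c₄Σ_ν α_ν∂_ν|x|⁻²`, degree `3`, `A = 8c₄r`, `B = Bdiff r` (for `α = ±e_μ` compare `fwdLeg`/`bwdLeg`, whose
sharper constants the plug uses).  Constants free of `(L,k)`. [folklore] -/
def diffLeg {α : Pt} {r : ℕ} (hα : supNorm α ≤ r) (hr : 1 ≤ r) : Leg where
  f L k w := T.g L k (w + α) - T.g L k w
  ℓ x := c4 * ∑ ν, toReal α ν * d1InvSq ν x
  a := 3
  A := 8 * c4 * r
  B := T.Bdiff r
  nonneg_A := by have := c4_pos.le; positivity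
  nonneg_B := by have := T.nonneg_B; have := T.nonneg_U; have := c4_pos.le; unfold Bdiff; positivity
  lead w hw := abs_sum_grad_cont_le hα hw
  err L k w hw := by
    have hs : (1 : ℝ) ≤ supNorm w := Leg.one_le_supNorm hw
    have hspos : (0 : ℝ) < supNorm w := by linarith
    have hr' : (1 : ℝ) ≤ r := by exact_mod_cast hr
    have hB := T.nonneg_B; have hU := T.nonneg_U; have hc := c4_pos.le
    rw [show (3 + 1 : ℕ) = 4 by norm_num]
    rcases le_or_gt (2 * r) (supNorm w) with hfar | hnear
    · refine (T.incr_bound L k hα hr hfar).trans (div_le_div_of_nonneg_right ?_ (by positivity))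
      unfold Bdiff
      have : 0 ≤ 16 * (2 * T.U + 8 * c4 * r) * (r : ℝ) ^ 4 := by positivity
      linarith
    · have ht : (supNorm w : ℝ) < 2 * r := by exact_mod_cast hnear
      have hpow : (supNorm w : ℝ) ^ 4 ≤ (2 * (r : ℝ)) ^ 4 := pow_le_pow_left₀ hspos.le ht.le 4
      have h1 := T.bdd L k (w + α)
      have h2 := T.bdd L k w
      have h3 : |c4 * ∑ ν, toReal α ν * d1InvSq ν (toReal w)| ≤ 8 * c4 * r :=
        (abs_sum_grad_cont_le hα hw).trans (div_le_self (by positivity) (one_le_pow₀ hs))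
      calc |T.g L k (w + α) - T.g L k w - c4 * ∑ ν, toReal α ν * d1InvSq ν (toReal w)|
          ≤ 2 * T.U + 8 * c4 * r := by
            have := abs_sub (T.g L k (w + α) - T.g L k w) (c4 * ∑ ν, toReal α ν * d1InvSq ν (toReal w))
            have := abs_sub (T.g L k (w + α)) (T.g L k w)
            linarith
        _ = (2 * T.U + 8 * c4 * r) * (supNorm w : ℝ) ^ 4 / (supNorm w : ℝ) ^ 4 := by field_simp
        _ ≤ T.Bdiff r / (supNorm w : ℝ) ^ 4 := by
            refine div_le_div_of_nonneg_right ?_ (by positivity)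
            unfold Bdiff
            nlinarith [mul_le_mul_of_nonneg_left hpow (by positivity : (0 : ℝ) ≤ 2 * T.U + 8 * c4 * r)]

/-- unfolding. [folklore] -/
@[simp] theorem diffLeg_f {α : Pt} {r : ℕ} (hα : supNorm α ≤ r) (hr : 1 ≤ r) (L k : ℕ) (w : Pt) :
    (T.diffLeg hα hr).f L k w = T.g L k (w + α) - T.g L k w := rfl
/-- unfolding. [folklore] -/
@[simp] theorem diffLeg_ℓ {α : Pt} {r : ℕ} (hα : supNorm α ≤ r) (hr : 1 ≤ r) (x : E4) :
    (T.diffLeg hα hr).ℓ x = c4 * ∑ ν, toReal α ν * d1InvSq ν x := rfl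
/-- unfolding. [folklore] -/
@[simp] theorem diffLeg_a {α : Pt} {r : ℕ} (hα : supNorm α ≤ r) (hr : 1 ≤ r) : (T.diffLeg hα hr).a = 3 := rfl

end TwoPower

/-! ## §3. SHARP differences (F3) ⇒ the mixed second-difference leg `c₄∂_μ∂_ν|x|⁻²`, no `Lawler137Shape` -/

/-- **(F3) SHARP UNIT DIFFERENCES**: `|g(v+e_i) − g(v) − c₄(1/|v+e_i|₂² − 1/|v|₂²)| ≤ B₃/‖v‖∞⁵` for `v ≠ 0` — the
forward differences of the family agree with those of the continuum leg THREE powers better than degree 2.  (At `k = 0`: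
lit1-g5's `latticeGreen_diff_sub_rpow_le_sharp`, §5.)  A `Prop`; asserts nothing. [folklore] -/
def SharpDiff (T : TwoPower) (B₃ : ℝ) : Prop :=
  ∀ L k : ℕ, ∀ v : Pt, v ≠ 0 → ∀ i : Fin 4,
    |T.g L k (v + unitVec i) - T.g L k v - c4 * (invSq (toReal (v + unitVec i)) - invSq (toReal v))| ≤
      B₃ / (supNorm v : ℝ) ^ 5

/-- The single Hessian entry on lattice points: `|∂_μ∂_ν|w|⁻²| ≤ 10/‖w‖∞⁴`. [folklore] -/
theorem abs_hessInvSq_le (μ ν : Fin 4) {w : Pt} (hw : w ≠ 0) :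
    |hessInvSq μ ν (toReal w)| ≤ 10 / (supNorm w : ℝ) ^ 4 := by
  have hs : (1 : ℝ) ≤ supNorm w := Leg.one_le_supNorm hw
  have hr : (supNorm w : ℝ) ^ 2 ≤ r2 (toReal w) := supNorm_sq_le_r2 w
  have hr0 : 0 < r2 (toReal w) := by nlinarith
  have hxμ : |toReal w μ| ≤ (supNorm w : ℝ) := by rw [← norm_toReal]; exact abs_apply_le_norm _ _
  have hxν : |toReal w ν| ≤ (supNorm w : ℝ) := by rw [← norm_toReal]; exact abs_apply_le_norm _ _
  have h1 : |8 * toReal w μ * toReal w ν / r2 (toReal w) ^ 3| ≤ 8 / (supNorm w : ℝ) ^ 4 := by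
    rw [abs_div, abs_of_pos (pow_pos hr0 3), abs_mul, abs_mul, show |(8 : ℝ)| = 8 by norm_num]
    rw [div_le_div_iff₀ (pow_pos hr0 3) (by positivity)]
    calc 8 * |toReal w μ| * |toReal w ν| * (supNorm w : ℝ) ^ 4
        ≤ 8 * (supNorm w : ℝ) * (supNorm w : ℝ) * (supNorm w : ℝ) ^ 4 := by gcongr
      _ = 8 * ((supNorm w : ℝ) ^ 2) ^ 3 := by ring
      _ ≤ 8 * r2 (toReal w) ^ 3 := by gcongr
  have h2 : |(if μ = ν then 2 / r2 (toReal w) ^ 2 else 0 : ℝ)| ≤ 2 / (supNorm w : ℝ) ^ 4 := by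
    split_ifs
    · rw [abs_of_pos (by positivity)]
      calc 2 / r2 (toReal w) ^ 2 ≤ 2 / ((supNorm w : ℝ) ^ 2) ^ 2 := by gcongr
        _ = 2 / (supNorm w : ℝ) ^ 4 := by ring
    · rw [abs_zero]; positivity
  unfold hessInvSq
  calc |8 * toReal w μ * toReal w ν / r2 (toReal w) ^ 3 - if μ = ν then 2 / r2 (toReal w) ^ 2 else 0|
      ≤ |8 * toReal w μ * toReal w ν / r2 (toReal w) ^ 3| + |(if μ = ν then 2 / r2 (toReal w) ^ 2 else 0 : ℝ)| :=
        abs_sub _ _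
    _ ≤ 8 / (supNorm w : ℝ) ^ 4 + 2 / (supNorm w : ℝ) ^ 4 := add_le_add h1 h2
    _ = 10 / (supNorm w : ℝ) ^ 4 := by ring

/-- **THE CONTINUUM MIXED SECOND DIFFERENCE vs THE HESSIAN ENTRY** (`μ ≠ ν`, `‖w‖∞ ≥ 2`):
`|1/|w+e_μ+e_ν|² − 1/|w+e_ν|² − 1/|w+e_μ|² + 1/|w|² − ∂_μ∂_ν|w|⁻²| ≤ 11136/‖w‖∞⁵` (three third-order expansions; linear
terms cancel, quadratic terms polarise to the entry). [folklore] -/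
theorem mixed_diff_invSq {μ ν : Fin 4} (hμν : μ ≠ ν) {w : Pt} (hw2 : 2 ≤ supNorm w) :
    |invSq (toReal (w + unitVec ν + unitVec μ)) - invSq (toReal (w + unitVec ν)) - invSq (toReal (w + unitVec μ)) +
        invSq (toReal w) - hessInvSq μ ν (toReal w)| ≤ 11136 / (supNorm w : ℝ) ^ 5 := by
  have hs2 : (2 : ℝ) ≤ supNorm w := by exact_mod_cast hw2
  have hw0 : w ≠ 0 := by intro h; have h0 := supNorm_eq_zero_iff.mpr h; omega
  have hX0 : toReal w ≠ 0 := fun h => hw0 (toReal_eq_zero_iff.mp h)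
  set X := toReal w with hXdef
  have hXn : ‖X‖ = supNorm w := norm_toReal w
  -- the three shifts
  have hn1 : ‖toReal (unitVec ν + unitVec μ)‖ = 1 := by
    rw [norm_toReal, add_comm, supNorm_unitVec_add hμν]; norm_num
  have hn2 : ‖toReal (unitVec ν)‖ = 1 := by rw [norm_toReal, supNorm_unitVec]; norm_num
  have hn3 : ‖toReal (unitVec μ)‖ = 1 := by rw [norm_toReal, supNorm_unitVec]; norm_num
  have t1 := taylor3_invSq (X := X) (ζ := toReal (unitVec ν + unitVec μ)) hX0 (by rw [hn1, hXn]; linarith)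
  have t2 := taylor3_invSq (X := X) (ζ := toReal (unitVec ν)) hX0 (by rw [hn2, hXn]; linarith)
  have t3 := taylor3_invSq (X := X) (ζ := toReal (unitVec μ)) hX0 (by rw [hn3, hXn]; linarith)
  rw [hn1] at t1; rw [hn2] at t2; rw [hn3] at t3
  rw [hXn] at t1 t2 t3
  simp only [one_pow, mul_one] at t1 t2 t3
  -- linear and quadratic bookkeeping
  have hlin : ∑ a, toReal (unitVec ν + unitVec μ) a * d1InvSq a X =
      ∑ a, toReal (unitVec ν) a * d1InvSq a X + ∑ a, toReal (unitVec μ) a * d1InvSq a X := by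
    rw [← Finset.sum_add_distrib]
    exact Finset.sum_congr rfl fun a _ => by rw [toReal_add, Pi.add_apply]; ring
  have hquad : ∑ a, ∑ b, toReal (unitVec ν + unitVec μ) a * toReal (unitVec ν + unitVec μ) b * hessInvSq a b X -
      ∑ a, ∑ b, toReal (unitVec ν) a * toReal (unitVec ν) b * hessInvSq a b X -
      ∑ a, ∑ b, toReal (unitVec μ) a * toReal (unitVec μ) b * hessInvSq a b X = 2 * hessInvSq μ ν X := by
    rw [toReal_add, quad_polar _ (fun a b => hessInvSq_symm a b X), sum_sum_toReal_unitVec_mul, hessInvSq_symm]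
  have e1 : toReal (w + unitVec ν + unitVec μ) = X + toReal (unitVec ν + unitVec μ) := by
    rw [add_assoc, toReal_add]
  have e2 : toReal (w + unitVec ν) = X + toReal (unitVec ν) := toReal_add _ _
  have e3 : toReal (w + unitVec μ) = X + toReal (unitVec μ) := toReal_add _ _
  rw [e1, e2, e3]
  -- abbreviate the three remainders
  set R1 := invSq (X + toReal (unitVec ν + unitVec μ)) - invSq X -
      ∑ a, toReal (unitVec ν + unitVec μ) a * d1InvSq a X -
      1 / 2 * ∑ a, ∑ b, toReal (unitVec ν + unitVec μ) a * toReal (unitVec ν + unitVec μ) b * hessInvSq a b X with hR1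
  set R2 := invSq (X + toReal (unitVec ν)) - invSq X - ∑ a, toReal (unitVec ν) a * d1InvSq a X -
      1 / 2 * ∑ a, ∑ b, toReal (unitVec ν) a * toReal (unitVec ν) b * hessInvSq a b X with hR2
  set R3 := invSq (X + toReal (unitVec μ)) - invSq X - ∑ a, toReal (unitVec μ) a * d1InvSq a X -
      1 / 2 * ∑ a, ∑ b, toReal (unitVec μ) a * toReal (unitVec μ) b * hessInvSq a b X with hR3
  have e : invSq (X + toReal (unitVec ν + unitVec μ)) - invSq (X + toReal (unitVec ν)) -
      invSq (X + toReal (unitVec μ)) + invSq X - hessInvSq μ ν X = R1 - R2 - R3 := by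
    rw [hR1, hR2, hR3, hlin]
    linear_combination ((1 : ℝ) / 2) * hquad
  rw [e]
  have hspos : (0 : ℝ) < supNorm w := by linarith
  calc |R1 - R2 - R3| ≤ |R1 - R2| + |R3| := abs_sub _ _
    _ ≤ (|R1| + |R2|) + |R3| := by gcongr; exact abs_sub _ _
    _ ≤ (3712 / (supNorm w : ℝ) ^ 5 + 3712 / (supNorm w : ℝ) ^ 5) + 3712 / (supNorm w : ℝ) ^ 5 := by
        gcongr
    _ = 11136 / (supNorm w : ℝ) ^ 5 := by ring

namespace TwoPower

variable (T : TwoPower)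

/-- The mixed leg's error constant. [folklore] -/
def Bmix (B₃ : ℝ) : ℝ := 33 * B₃ + 11136 * c4 + 1024 * (4 * T.U + 10 * c4)

/-- **THE MIXED SECOND-DIFFERENCE LEG from (F1)+(F2)+(F3)** (`μ ≠ ν`):
`f = g(·+e_ν+e_μ) − g(·+e_ν) − g(·+e_μ) + g`, continuum part `c₄∂_μ∂_ν|x|⁻²`, degree `4`, `A = 10c₄`,
`B = 33B₃ + 11136c₄ + 1024(4U + 10c₄)`.  No `Lawler137Shape`, no polarisation of three legs. [folklore] -/
def mixedLeg {μ ν : Fin 4} (hμν : μ ≠ ν) {B₃ : ℝ} (hB : 0 ≤ B₃) (h : SharpDiff T B₃) : Leg where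
  f L k w := T.g L k (w + unitVec ν + unitVec μ) - T.g L k (w + unitVec ν) - T.g L k (w + unitVec μ) + T.g L k w
  ℓ x := c4 * hessInvSq μ ν x
  a := 4
  A := 10 * c4
  B := T.Bmix B₃
  nonneg_A := mul_nonneg (by norm_num) c4_pos.le
  nonneg_B := by have := T.nonneg_U; have := c4_pos.le; unfold Bmix; positivity
  lead w hw := by
    rw [abs_mul, abs_of_pos c4_pos]
    calc c4 * |hessInvSq μ ν (toReal w)| ≤ c4 * (10 / (supNorm w : ℝ) ^ 4) :=
        mul_le_mul_of_nonneg_left (abs_hessInvSq_le μ ν hw) c4_pos.le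
      _ = 10 * c4 / (supNorm w : ℝ) ^ 4 := by ring
  err L k w hw := by
    have hs : (1 : ℝ) ≤ supNorm w := Leg.one_le_supNorm hw
    have hspos : (0 : ℝ) < supNorm w := by linarith
    have hU := T.nonneg_U
    have hc := c4_pos
    rcases le_or_gt 4 (supNorm w) with h4 | h4
    · -- far field
      have hs4 : (4 : ℝ) ≤ supNorm w := by exact_mod_cast h4
      have hwν : (supNorm w : ℝ) - 1 ≤ supNorm (w + unitVec ν) := by
        have := supNorm_sub_le_supNorm_add w (unitVec ν); rw [supNorm_unitVec] at this; simpa using this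
      have hwν0 : w + unitVec ν ≠ 0 := by
        intro h0; have h00 := supNorm_eq_zero_iff.mpr h0; rw [h00] at hwν; norm_num at hwν; linarith
      have hD1 := h L k (w + unitVec ν) hwν0 μ
      have hD2 := h L k w hw μ
      have hcont := mixed_diff_invSq hμν (w := w) (by omega)
      have hwν1 : (1 : ℝ) ≤ supNorm (w + unitVec ν) := by linarith
      have hD1' : B₃ / (supNorm (w + unitVec ν) : ℝ) ^ 5 ≤ 32 * B₃ / (supNorm w : ℝ) ^ 5 := by
        rw [div_le_div_iff₀ (by positivity) (by positivity)]
        have h12 : (supNorm w : ℝ) / 2 ≤ supNorm (w + unitVec ν) := by linarith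
        have := pow_le_pow_left₀ (by positivity) h12 5
        nlinarith
      have e : T.g L k (w + unitVec ν + unitVec μ) - T.g L k (w + unitVec ν) - T.g L k (w + unitVec μ) + T.g L k w -
          c4 * hessInvSq μ ν (toReal w) =
          (T.g L k (w + unitVec ν + unitVec μ) - T.g L k (w + unitVec ν) -
              c4 * (invSq (toReal (w + unitVec ν + unitVec μ)) - invSq (toReal (w + unitVec ν)))) -
            (T.g L k (w + unitVec μ) - T.g L k w - c4 * (invSq (toReal (w + unitVec μ)) - invSq (toReal w))) +
            c4 * (invSq (toReal (w + unitVec ν + unitVec μ)) - invSq (toReal (w + unitVec ν)) -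
              invSq (toReal (w + unitVec μ)) + invSq (toReal w) - hessInvSq μ ν (toReal w)) := by ring
      rw [e]
      calc |(T.g L k (w + unitVec ν + unitVec μ) - T.g L k (w + unitVec ν) -
              c4 * (invSq (toReal (w + unitVec ν + unitVec μ)) - invSq (toReal (w + unitVec ν)))) -
            (T.g L k (w + unitVec μ) - T.g L k w - c4 * (invSq (toReal (w + unitVec μ)) - invSq (toReal w))) +
            c4 * (invSq (toReal (w + unitVec ν + unitVec μ)) - invSq (toReal (w + unitVec ν)) -
              invSq (toReal (w + unitVec μ)) + invSq (toReal w) - hessInvSq μ ν (toReal w))|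
          ≤ |(T.g L k (w + unitVec ν + unitVec μ) - T.g L k (w + unitVec ν) -
              c4 * (invSq (toReal (w + unitVec ν + unitVec μ)) - invSq (toReal (w + unitVec ν)))) -
            (T.g L k (w + unitVec μ) - T.g L k w - c4 * (invSq (toReal (w + unitVec μ)) - invSq (toReal w)))| +
            |c4 * (invSq (toReal (w + unitVec ν + unitVec μ)) - invSq (toReal (w + unitVec ν)) -
              invSq (toReal (w + unitVec μ)) + invSq (toReal w) - hessInvSq μ ν (toReal w))| := abs_add_le _ _
        _ ≤ (|T.g L k (w + unitVec ν + unitVec μ) - T.g L k (w + unitVec ν) -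
              c4 * (invSq (toReal (w + unitVec ν + unitVec μ)) - invSq (toReal (w + unitVec ν)))| +
            |T.g L k (w + unitVec μ) - T.g L k w - c4 * (invSq (toReal (w + unitVec μ)) - invSq (toReal w))|) +
            c4 * |invSq (toReal (w + unitVec ν + unitVec μ)) - invSq (toReal (w + unitVec ν)) -
              invSq (toReal (w + unitVec μ)) + invSq (toReal w) - hessInvSq μ ν (toReal w)| := by
            rw [abs_mul, abs_of_pos c4_pos]
            gcongr
            exact abs_sub _ _
        _ ≤ (32 * B₃ / (supNorm w : ℝ) ^ 5 + B₃ / (supNorm w : ℝ) ^ 5) + c4 * (11136 / (supNorm w : ℝ) ^ 5) := by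
            gcongr
            · exact hD1.trans hD1'
        _ = (33 * B₃ + 11136 * c4) / (supNorm w : ℝ) ^ 5 := by ring
        _ ≤ T.Bmix B₃ / (supNorm w : ℝ) ^ (4 + 1) := by
            rw [show (4 + 1 : ℕ) = 5 by norm_num]
            gcongr
            unfold Bmix; nlinarith
    · -- near field: 1 ≤ ‖w‖ ≤ 3
      have hs3 : (supNorm w : ℝ) ≤ 3 := by exact_mod_cast (by omega : supNorm w ≤ 3)
      have hb1 := T.bdd L k (w + unitVec ν + unitVec μ)
      have hb2 := T.bdd L k (w + unitVec ν)
      have hb3 := T.bdd L k (w + unitVec μ)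
      have hb4 := T.bdd L k w
      have hl : |c4 * hessInvSq μ ν (toReal w)| ≤ 10 * c4 := by
        rw [abs_mul, abs_of_pos c4_pos]
        calc c4 * |hessInvSq μ ν (toReal w)| ≤ c4 * (10 / (supNorm w : ℝ) ^ 4) :=
            mul_le_mul_of_nonneg_left (abs_hessInvSq_le μ ν hw) c4_pos.le
          _ ≤ c4 * (10 / 1) := by gcongr; exact one_le_pow₀ hs
          _ = 10 * c4 := by ring
      have hsum : |T.g L k (w + unitVec ν + unitVec μ) - T.g L k (w + unitVec ν) - T.g L k (w + unitVec μ) +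
          T.g L k w - c4 * hessInvSq μ ν (toReal w)| ≤ 4 * T.U + 10 * c4 := by
        have a1 := abs_sub (T.g L k (w + unitVec ν + unitVec μ) - T.g L k (w + unitVec ν) -
          T.g L k (w + unitVec μ) + T.g L k w) (c4 * hessInvSq μ ν (toReal w))
        have a2 := abs_add_le (T.g L k (w + unitVec ν + unitVec μ) - T.g L k (w + unitVec ν) -
          T.g L k (w + unitVec μ)) (T.g L k w)
        have a3 := abs_sub (T.g L k (w + unitVec ν + unitVec μ) - T.g L k (w + unitVec ν))
          (T.g L k (w + unitVec μ))
        have a4 := abs_sub (T.g L k (w + unitVec ν + unitVec μ)) (T.g L k (w + unitVec ν))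
        linarith
      calc |T.g L k (w + unitVec ν + unitVec μ) - T.g L k (w + unitVec ν) - T.g L k (w + unitVec μ) + T.g L k w -
            c4 * hessInvSq μ ν (toReal w)| ≤ 4 * T.U + 10 * c4 := hsum
        _ = (1024 * (4 * T.U + 10 * c4)) / 4 ^ 5 := by norm_num
        _ ≤ (1024 * (4 * T.U + 10 * c4)) / (supNorm w : ℝ) ^ 5 := by
            apply div_le_div_of_nonneg_left (by positivity) (by positivity)
            exact pow_le_pow_left₀ hspos.le (by linarith) 5
        _ ≤ T.Bmix B₃ / (supNorm w : ℝ) ^ (4 + 1) := by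
            rw [show (4 + 1 : ℕ) = 5 by norm_num]
            gcongr
            unfold Bmix; nlinarith

/-- The mixed leg's continuum part. [folklore] -/
@[simp] theorem mixedLeg_ℓ {μ ν : Fin 4} (hμν : μ ≠ ν) {B₃ : ℝ} (hB : 0 ≤ B₃) (h : SharpDiff T B₃) (x : E4) :
    (T.mixedLeg hμν hB h).ℓ x = c4 * hessInvSq μ ν x := rfl

/-- The mixed leg's degree. [folklore] -/
@[simp] theorem mixedLeg_a {μ ν : Fin 4} (hμν : μ ≠ ν) {B₃ : ℝ} (hB : 0 ≤ B₃) (h : SharpDiff T B₃) :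
    (T.mixedLeg hμν hB h).a = 4 := rfl

end TwoPower

/-! ## §4. THE PLUG: (F1)+(F2) [+ (F3) or any two-derivative leg] + (W2) + (W3) + window ⇒ the wall -/

section Plug

variable (T : TwoPower) {μ ν : Fin 4} {N : ℝ}

/-- **THE WALL FROM A TWO-POWER FAMILY AND A TWO-DERIVATIVE LEG**: legs `P₀ := baseLeg`, `Dμ := fwdLeg μ`,
`Dν := fwdLeg ν` of the family, any `H` with continuum part `c₄∂_μ∂_ν|x|⁻²` and degree `4`; (W2) relative to this table,
(W3), window comparability ⟹ `stepBal N L − A ≤ β⁰(L,k)` for all `L ≥ 2`, `k`. [folklore] -/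
theorem stepBal_le_of_twoPower (hμν : μ ≠ ν) (hN : N ≠ 0) {H : Leg}
    (hH : ∀ x, H.ℓ x = c4 * hessInvSq μ ν x) (hHa : H.a = 4)
    {β0 : ℕ → ℕ → ℝ} {K : ℕ → ℕ → Pt → ℝ} {A₁' D cc : ℝ} {M : ℕ → ℕ} (hD : 0 ≤ D) (hc : 1 ≤ cc)
    (hM : ∀ L : ℕ, 2 ≤ L → 1 ≤ M L ∧ (L : ℝ) ≤ cc * M L) (hML : ∀ L : ℕ, 2 ≤ L → M L ≤ L)
    (hin : ∀ L : ℕ, 2 ≤ L → ∀ k : ℕ, ∀ w : Pt, w ≠ 0 →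
      |K L k w - toReal w μ * toReal w ν *
          lattBubble Finset.univ ![2 * N * N * 6, 2 * N * N * 10] ![T.baseLeg, T.fwdLeg μ] ![H, T.fwdLeg ν] L k w| ≤
        D / ((supNorm w : ℝ) ^ 2 * (L : ℝ) ^ 2))
    (hout : ∀ L : ℕ, 2 ≤ L → ∀ k : ℕ, |β0 L k - ∑ w ∈ annulus 4 0 (M L), K L k w| ≤ A₁') :
    ∀ L : ℕ, 2 ≤ L → ∀ k : ℕ,
      B12Normalization.stepBal N L - WindowDecomposition.constA (|kappaBal N| * 24 + |kappaBal N| * 110592)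
        (bubbleConst Finset.univ ![2 * N * N * 6, 2 * N * N * 10] ![T.baseLeg, T.fwdLeg μ] ![H, T.fwdLeg ν])
          (A₁' + 80 * D) cc (kappaBal N * transverseValue) ≤ β0 L k :=
  stepBal_le_of_bfInterface hμν hN (T.baseLeg_ℓ) hH (T.fwdLeg_ℓ μ) (T.fwdLeg_ℓ ν) (by rw [hHa]; rfl)
    (by rfl) hD hc hM hML hin hout

/-- **THE WALL FROM (F1)+(F2)+(F3) ALONE** — the two-derivative leg is `mixedLeg` of §3: the (W1) legs of the family `g`
are now THREE scalar inequalities with `(L,k)`-free constants. [folklore] -/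
theorem stepBal_le_of_twoPowerSharp (hμν : μ ≠ ν) (hN : N ≠ 0) {B₃ : ℝ} (hB : 0 ≤ B₃) (h : SharpDiff T B₃)
    {β0 : ℕ → ℕ → ℝ} {K : ℕ → ℕ → Pt → ℝ} {A₁' D cc : ℝ} {M : ℕ → ℕ} (hD : 0 ≤ D) (hc : 1 ≤ cc)
    (hM : ∀ L : ℕ, 2 ≤ L → 1 ≤ M L ∧ (L : ℝ) ≤ cc * M L) (hML : ∀ L : ℕ, 2 ≤ L → M L ≤ L)
    (hin : ∀ L : ℕ, 2 ≤ L → ∀ k : ℕ, ∀ w : Pt, w ≠ 0 →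
      |K L k w - toReal w μ * toReal w ν *
          lattBubble Finset.univ ![2 * N * N * 6, 2 * N * N * 10] ![T.baseLeg, T.fwdLeg μ]
            ![T.mixedLeg hμν hB h, T.fwdLeg ν] L k w| ≤ D / ((supNorm w : ℝ) ^ 2 * (L : ℝ) ^ 2))
    (hout : ∀ L : ℕ, 2 ≤ L → ∀ k : ℕ, |β0 L k - ∑ w ∈ annulus 4 0 (M L), K L k w| ≤ A₁') :
    ∀ L : ℕ, 2 ≤ L → ∀ k : ℕ,
      B12Normalization.stepBal N L - WindowDecomposition.constA (|kappaBal N| * 24 + |kappaBal N| * 110592)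
        (bubbleConst Finset.univ ![2 * N * N * 6, 2 * N * N * 10] ![T.baseLeg, T.fwdLeg μ]
          ![T.mixedLeg hμν hB h, T.fwdLeg ν]) (A₁' + 80 * D) cc (kappaBal N * transverseValue) ≤ β0 L k :=
  stepBal_le_of_twoPower T hμν hN (T.mixedLeg_ℓ hμν hB h) (T.mixedLeg_a hμν hB h) hD hc hM hML hin hout

end Plug

/-! ## §5. THE FREE RUNG UNCONDITIONALLY: `latticeGreen/2` is a `TwoPower` family with SHARP differences (lit1 v1.1) -/

section Free

/-- (F2) for the free Green function: `|latticeGreen v/2| ≤ |latticeGreen 0|/2 + c₄ + B_free` for all `v`. [folklore] -/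
theorem abs_latticeGreen_half_le (v : Pt) :
    |latticeGreen v / 2| ≤ |latticeGreen (0 : Pt)| / 2 + c4 + freeLeg.B := by
  have hc := c4_pos.le
  have hB := freeLeg.nonneg_B
  by_cases hv : v = 0
  · subst hv; rw [abs_div, abs_two]; linarith
  · have h := freeLeg.abs_f_le 0 0 hv
    simp only [freeLeg_f, freeLeg_a] at h
    have hs : (1 : ℝ) ≤ supNorm v := Leg.one_le_supNorm hv
    have h2 : (freeLeg.A + freeLeg.B) / (supNorm v : ℝ) ^ 2 ≤ freeLeg.A + freeLeg.B :=
      div_le_self (add_nonneg freeLeg.nonneg_A hB) (one_le_pow₀ hs)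
    have hA : freeLeg.A = c4 := rfl
    have := h.trans h2
    rw [hA] at this
    have h0 : 0 ≤ |latticeGreen (0 : Pt)| / 2 := by positivity
    linarith

/-- **THE FREE FAMILY** `g L k := latticeGreen/2` (all `(L,k)`): (F1) = `BubbleTransfer.free_leg_bound` (Lawler–Limic
Thm 4.3.1 via the tree, two powers better), (F2) = `abs_latticeGreen_half_le`. [folklore] -/
def free : TwoPower where
  g _ _ v := latticeGreen v / 2
  B := freeLeg.B
  U := |latticeGreen (0 : Pt)| / 2 + c4 + freeLeg.B
  nonneg_B := freeLeg.nonneg_B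
  nonneg_U := by have := c4_pos.le; have := freeLeg.nonneg_B; positivity
  err4 L k v hv := (Classical.choose_spec free_leg_bound).2 v hv
  bdd L k v := abs_latticeGreen_half_le v

/-- unfolding. [folklore] -/
@[simp] theorem free_g (L k : ℕ) (v : Pt) : free.g L k v = latticeGreen v / 2 := rfl

/-- `|x|₂^{2−4}` on lattice points is `invSq ∘ toReal` — for ALL `w` (at `w = 0` both sides are the junk value `0`).
[folklore] -/
theorem sqrt_rpow_two_sub_four_all (w : Pt) :
    Real.sqrt (∑ j, ((w j : ℤ) : ℝ) ^ 2) ^ ((2 : ℝ) - 4) = invSq (toReal w) := by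
  by_cases hw : w = 0
  · subst hw
    simp [invSq, r2, toReal, Real.zero_rpow (show ((2 : ℝ) - 4) ≠ 0 by norm_num)]
  · rw [sqrt_rpow_two_sub_four hw, invSq]

/-- **(F3) FOR THE FREE FAMILY IS lit1-g5's SHARP (1.36)** (`latticeGreen_diff_sub_rpow_le_sharp`, KERNEL): the forward
differences of `latticeGreen/2 − c₄|·|₂⁻²` are `O(‖v‖∞⁻⁵)`. [folklore] -/
theorem free_sharp : ∃ B₃ : ℝ, 0 ≤ B₃ ∧ SharpDiff free B₃ := by
  obtain ⟨K, hK0, hK⟩ := Literature.Probability.LatticeModels.latticeGreen_diff_sub_rpow_le_sharp (d := 4) (by norm_num)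
  refine ⟨K / 2, by positivity, fun L k v hv i => ?_⟩
  have h := hK v hv i
  simp only [Nat.cast_ofNat] at h
  rw [green_const_four, sqrt_rpow_two_sub_four_all, sqrt_rpow_two_sub_four_all,
    show -((4 : ℝ) + 1) = -((5 : ℕ) : ℝ) by norm_num] at h
  have h5 := sqrt_rpow_neg_le hv 5
  have hs : (1 : ℝ) ≤ supNorm v := Leg.one_le_supNorm hv
  change |latticeGreen (v + unitVec i) / 2 - latticeGreen v / 2 -
      c4 * (invSq (toReal (v + unitVec i)) - invSq (toReal v))| ≤ K / 2 / (supNorm v : ℝ) ^ 5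
  have e : latticeGreen (v + unitVec i) / 2 - latticeGreen v / 2 -
      c4 * (invSq (toReal (v + unitVec i)) - invSq (toReal v)) =
      (latticeGreen (v + unitVec i) - latticeGreen v -
        2 * c4 * (invSq (toReal (v + unitVec i)) - invSq (toReal v))) / 2 := by ring
  rw [e, abs_div, abs_two]
  calc |latticeGreen (v + unitVec i) - latticeGreen v - 2 * c4 * (invSq (toReal (v + unitVec i)) - invSq (toReal v))| / 2
      ≤ (K * Real.sqrt (∑ j, ((v j : ℤ) : ℝ) ^ 2) ^ (-((5 : ℕ) : ℝ))) / 2 := by gcongr; exact h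
    _ ≤ (K * (1 / (supNorm v : ℝ) ^ 5)) / 2 := by gcongr
    _ = K / 2 / (supNorm v : ℝ) ^ 5 := by ring

/-- The free family's mixed second-difference leg `c₄∂_μ∂_ν|x|⁻²` (`μ ≠ ν`), UNCONDITIONAL. [folklore] -/
def freeMixedLeg {μ ν : Fin 4} (hμν : μ ≠ ν) : Leg :=
  free.mixedLeg hμν (Classical.choose_spec free_sharp).1 (Classical.choose_spec free_sharp).2

/-- Its continuum part. [folklore] -/
@[simp] theorem freeMixedLeg_ℓ {μ ν : Fin 4} (hμν : μ ≠ ν) (x : E4) :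
    (freeMixedLeg hμν).ℓ x = c4 * hessInvSq μ ν x := rfl

/-- Its degree. [folklore] -/
@[simp] theorem freeMixedLeg_a {μ ν : Fin 4} (hμν : μ ≠ ν) : (freeMixedLeg hμν).a = 4 := rfl

/-- The free family's legs are `freeLeg`'s function and `gradLegFwd`'s function (consistency with BubbleTransfer §7).
[folklore] -/
theorem free_baseLeg_f (L k : ℕ) (w : Pt) : free.baseLeg.f L k w = freeLeg.f L k w := rfl

/-- idem for the forward gradient. [folklore] -/
theorem free_fwdLeg_f (μ : Fin 4) (L k : ℕ) (w : Pt) : (free.fwdLeg μ).f L k w = (gradLegFwd μ).f L k w := by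
  simp [TwoPower.fwdLeg, gradLegFwd, unitVec]; ring

/-- **THE FREE RUNG WITH NO (1.37) HYPOTHESIS**: `WindowInterface.stepBal_le_of_freeInterface` with its three
`Lawler137Shape` hypotheses DISCHARGED (replaced by lit1-g5's kernel theorem through `freeMixedLeg`): for the free
background-field table at `k = 0` — legs `latticeGreen/2`, `∇⁺_μ latticeGreen/2`, the mixed second difference,
`∇⁺_ν latticeGreen/2` — (W2) relative to it, (W3), window comparability ⟹ `stepBal N L − A ≤ β⁰(L,k)`.  Whether Bałaban's
`k = 0` integrand reduces to this table is items (iii)–(v), NOT asserted. [folklore] -/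
theorem stepBal_le_of_freeSharp {μ ν : Fin 4} (hμν : μ ≠ ν) {N : ℝ} (hN : N ≠ 0)
    {β0 : ℕ → ℕ → ℝ} {K : ℕ → ℕ → Pt → ℝ} {A₁' D cc : ℝ} {M : ℕ → ℕ} (hD : 0 ≤ D) (hc : 1 ≤ cc)
    (hM : ∀ L : ℕ, 2 ≤ L → 1 ≤ M L ∧ (L : ℝ) ≤ cc * M L) (hML : ∀ L : ℕ, 2 ≤ L → M L ≤ L)
    (hin : ∀ L : ℕ, 2 ≤ L → ∀ k : ℕ, ∀ w : Pt, w ≠ 0 →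
      |K L k w - toReal w μ * toReal w ν *
          lattBubble Finset.univ ![2 * N * N * 6, 2 * N * N * 10] ![free.baseLeg, free.fwdLeg μ]
            ![freeMixedLeg hμν, free.fwdLeg ν] L k w| ≤ D / ((supNorm w : ℝ) ^ 2 * (L : ℝ) ^ 2))
    (hout : ∀ L : ℕ, 2 ≤ L → ∀ k : ℕ, |β0 L k - ∑ w ∈ annulus 4 0 (M L), K L k w| ≤ A₁') :
    ∀ L : ℕ, 2 ≤ L → ∀ k : ℕ,
      B12Normalization.stepBal N L - WindowDecomposition.constA (|kappaBal N| * 24 + |kappaBal N| * 110592)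
        (bubbleConst Finset.univ ![2 * N * N * 6, 2 * N * N * 10] ![free.baseLeg, free.fwdLeg μ]
          ![freeMixedLeg hμν, free.fwdLeg ν]) (A₁' + 80 * D) cc (kappaBal N * transverseValue) ≤ β0 L k :=
  stepBal_le_of_twoPowerSharp free hμν hN _ _ hD hc hM hML hin hout

end Free

end Literature.MathematicalPhysics.QuantumFieldTheory.Balaban1983to89.Beta.TwoPowerLegs
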